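/-
Copyright (c) 2026 the pub-hodgecm-mathlib formalisation cell (harness21).  Prover seat hodgecm-mathlib-F0P3a-p06 (g18), 2026-09-02: «DIFFERENT = CONDUCTOR» at a wild ramified
CM place — the junction of ★ `RamifiedPlaceDifferent` (integral side) with B-p14 (g42)'s ★ `WildQuadraticNormsCMBridge` (norm side).
-/
import Literature.NumberTheory.Automorphic.RamifiedPlaceDifferent        -- ★ F0P3a-p06 (g18): `valued_galAdicCompletionMap_sub_self_of_uniformizer`, `galAdicCompletionMap_sub_galAdicCompletionMap_self`, `sq_ne_sq_mul_exp_neg_one`, …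
import Literature.NumberTheory.LocalFields.WildQuadraticNormsCMBridge     -- ★ B-p14 (g42): `IsCMField.norm_filtration_place_of_valued_odd`, `IsCMField.norm_filtration_place_of_odd_defect`
import HarnessLib

/-!
# DIFFERENT = CONDUCTOR at a wild ramified CM place: `U^{(k)}(L⁺_v) ⊆ N(L_w^×) ⟺ exp(−k) ≤ |σ_w τ − τ|_w`
# (Serre, *Local Fields* V §3 Cor. 3, XV §2; the quadratic case of the conductor–discriminant formula)

Topic `NumberTheory/Automorphic`; namespace `Literature.NumberTheory.Automorphic.UnitaryGroup`.  THEOREMS ONLY (no definition, no instance, no notation, no named fact,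
no `sorry`; axioms ⊆ {propext, Classical.choice, Quot.sound}).  Cell `pub/hodgecm-mathlib` (D-0151), crux H413 = `stmt-HodgeConjecture-24833`; half A line LH4, DYADIC
pay-down leaf `Cruxes/H413/Lines/F0_P3c_DyadicPaydown.lean`, organ (D-RAM) (PRINT by ruling D74′; census F0P3a-p06 (g17) `DUNR-H2-CENSUS.md` §4).  HONEST LABEL: HC_CM is
proved only modulo the 7 printed citations (2 remaining named inputs: hLiu418 = stmt-HodgeConjecture-24832, h413 = stmt-HodgeConjecture-24833) until rung 0 closes; this file is
unconditional local algebra, count-neutral, consumers none live this week.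

THE THEOREM.  `L` CM, `w ∣ v` non-split RAMIFIED, `v ∣ 2` (`|2|_v < 1`), `σ = σ_w`, `ι = toPlace v w : L⁺_v → L_w`, `τ` any uniformiser of `L_w`, `d` the different number
(`|στ − τ|_w = exp(−d)`, ★ `exists_different_of_ramified`).  Then for every `k : ℕ`:
**every unit `x ∈ L⁺_v` with `|x − 1|_v ≤ exp(−k)` is a norm `z · σ_w z` ⟺ `exp(−k) ≤ |στ − τ|_w`** (`forall_exists_mul_galAdicCompletionMap_eq_iff_exp_neg_le`), i.e. the
conductor `f` of `L_w ∕ L⁺_v` (the least `k` with `U^{(k)} ⊆ N`, ★ `IsCMField.conductor_iff_place`) EQUALS `d` — both valuations normalised (`|ϖ_v|_v = exp(−1) = |τ|_w`).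
NORMALISATIONS IN ONE SENTENCE (LH4-plan (g5) WORD #2 (a)): `d` is the `w`-normalised DIFFERENT exponent `v_w(𝔇_{w∕v})`; since `L_w ∕ L⁺_v` is totally ramified of degree 2,
`N_{w∕v} 𝔭_w = 𝔭_v`, so `d` is ALSO the `v`-normalised DISCRIMINANT exponent `v_v(𝔡_{w∕v}) = v_v(N 𝔇)`, which by the conductor–discriminant formula is the Artin∕norm conductor
`f(χ_{L_w∕L⁺_v})` — no factor `e = 2` anywhere [Serre1979 VI §2 Cor. 2; NeukirchANT1999 VII (11.9)].
PROOF.  `δ := τ − στ` is a skew generator with `ι(u² + 4v) = δ²` (`τ + στ = ι u`, `τ·στ = −ι v`, ★ Eisenstein coefficients).  By ★ `valued_galAdicCompletionMap_sub_self_of_uniformizer`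
`|στ − τ| = max |ι u| |2τ|` and the two values differ in parity:
* `|ι u| < |2τ|` (`d = 2·ord_v 2 + 1`): `|u²|_v < |4v|_v`, so `d₀ := u² + 4v` has ODD order and ★ B-p14 `IsCMField.norm_filtration_place_of_valued_odd` gives «norm iff
  `|x − 1|_v < |4|_v`» with a sharp non-norm unit at `|x − 1| = |4|`: conductor `2·ord_v 2 + 1 = d`;
* `|2τ| < |ι u|` (`d = 2·ord_v u`): `δ′ := ι u⁻¹ · δ` has `δ′² = ι(1 + w′)`, `w′ := 4v∕u²` of ODD valuation with `|4| < |w′| < 1`, and ★ `IsCMField.norm_filtration_place_of_odd_defect`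
  gives «norm iff `|w′(x − 1)| < |4|`», i.e. `|x − 1| ≤ |u|² = exp(−d)`, with a sharp non-norm unit one step below: conductor `d`.
* §1 `toPlace_eq_algebraMap_place` (the ★ `SemiLocal.Place` ∕ `PlacesOver` junction, `rfl`), `toPlace_trace_sq_add_four_mul_eq` (`ι(u² + 4v) = (τ − στ)²`).
* §2 the two cases `forall_exists_mul_galAdicCompletionMap_eq_iff_of_lt` ∕ `…_of_gt`; §3 the head and its `exists_different` corollary `exists_different_eq_conductor_of_ramified`.

## References
* [Serre1979] J.-P. Serre, *Local Fields*, GTM 67 (1979): Ch. V §3 Prop. 5 & Cor. 3 (`N(U_L^{ψ(n)}) = U_K^n` for `n ≥ t + 1`, cyclic totally ramified of prime degree),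
  Ch. IV §1 Prop. 4, Ch. XV §2 (conductor), Ch. III §6.
* [NeukirchANT1999] J. Neukirch, *Algebraic Number Theory* (1999): Ch. VII (11.9) (conductor–discriminant formula), Ch. V (1.3).
* [Omeara1963] O. T. O'Meara, *Introduction to Quadratic Forms* (1963): §63A–B (local norm groups at dyadic places).
-/

set_option autoImplicit false

noncomputable section

open NumberField IsDedekindDomain ValuativeRel
open scoped ValuativeRel WithZero

namespace Literature.NumberTheory.Automorphic.UnitaryGroup

open Literature.NumberTheory.GaloisRepresentations (SemiLocal.Place)

variable (L : Type) [Field L] [NumberField L] [IsCMField L] (v : HeightOneSpectrum (𝓞 ↥(maximalRealSubfield L)))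
  (w : PlacesOver L v) (hw : IsCMField.complexConj L • w.1 = w.1) (he : v.asIdeal.ramificationIdx' w.1.asIdeal ≠ 1)

/-! ## §1 The junction with the `SemiLocal.Place` currency, and the skew generator `τ − στ` -/

omit [IsCMField L] in
/-- `toPlace v w` IS the structure map `algebraMap L⁺_v L_w` of ★ `SemiLocal.Place.algebraPlace` at the place `⟨w.1, w.2⟩` (both are `adicCompletionOfLiesOver`, the canonical
embedding `K_v → L_w` of the completions) — the junction between the `PlacesOver`∕`toPlace` currency of the unitary files and the `SemiLocal.Place`∕`algebraMap` currency of ★ (J2)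
`QuadraticLocalNormFixedRange` and ★ `WildQuadraticNormsCMBridge`. [cite: CasselsFrohlichANT1967, Ch. II §10] -/
theorem toPlace_eq_algebraMap_place :
    toPlace v w = algebraMap (v.adicCompletion ↥(maximalRealSubfield L))
      (((⟨w.1, w.2⟩ : SemiLocal.Place ↥(maximalRealSubfield L) L v) : HeightOneSpectrum (𝓞 L)).adicCompletion L) := rfl

/-- `ι(u² + 4v) = (τ − στ)·(τ − στ)` for `τ + στ = ι u`, `τ·στ = −ι v`: the square of the skew element `τ − στ` descends. [cite: Serre1979, Ch. IV §2] -/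
theorem toPlace_trace_sq_add_four_mul_eq {τ : w.1.adicCompletion L} {u v₀ : v.adicCompletion ↥(maximalRealSubfield L)}
    (htr : τ + galAdicCompletionMap (L := L) (IsCMField.complexConj L) hw τ = toPlace v w u)
    (hnm : τ * galAdicCompletionMap (L := L) (IsCMField.complexConj L) hw τ = -toPlace v w v₀) :
    toPlace v w (u ^ 2 + 4 * v₀) =
      (τ - galAdicCompletionMap (L := L) (IsCMField.complexConj L) hw τ) * (τ - galAdicCompletionMap (L := L) (IsCMField.complexConj L) hw τ) := by
  rw [map_add, map_pow, map_mul, map_ofNat, ← htr]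
  linear_combination (4 : w.1.adicCompletion L) * hnm

omit [IsCMField L] in
/-- `|4 v|_v = |2|_v² · exp(−1)` for `|v| = exp(−1)`. [cite: Serre1979, Ch. II §1] -/
theorem valued_four_mul_of_uniformizer {v₀ : v.adicCompletion ↥(maximalRealSubfield L)} (hv₀ : Valued.v v₀ = WithZero.exp (-1 : ℤ)) :
    Valued.v (4 * v₀) = Valued.v (2 : v.adicCompletion ↥(maximalRealSubfield L)) ^ 2 * WithZero.exp (-1 : ℤ) := by
  rw [map_mul, hv₀, show (4 : v.adicCompletion ↥(maximalRealSubfield L)) = 2 ^ 2 by norm_num, map_pow]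

/-- In `ℤᵐ⁰`: `a < b · exp 1 ↔ a ≤ b` for `b ≠ 0` (one integer step). [cite: Serre1979, Ch. II §1] -/
theorem lt_mul_exp_one_iff_le {a b : WithZero (Multiplicative ℤ)} (hb : b ≠ 0) : a < b * WithZero.exp (1 : ℤ) ↔ a ≤ b := by
  obtain ⟨n, hn⟩ : ∃ n : ℤ, b = WithZero.exp n := ⟨_, (WithZero.exp_log hb).symm⟩
  rcases eq_or_ne a 0 with ha | ha
  · rw [ha, hn, ← WithZero.exp_add]; exact ⟨fun _ => zero_le, fun _ => zero_lt_iff.2 WithZero.coe_ne_zero⟩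
  obtain ⟨m, hm⟩ : ∃ m : ℤ, a = WithZero.exp m := ⟨_, (WithZero.exp_log ha).symm⟩
  rw [hm, hn, ← WithZero.exp_add, WithZero.exp_lt_exp, WithZero.exp_le_exp]
  omega

/-- In `ℤᵐ⁰`: `exp(−k) < b ↔ exp(−k) ≤ b · exp(−1)` for `b ≠ 0` (one integer step). [cite: Serre1979, Ch. II §1] -/
theorem exp_lt_iff_le_mul_exp_neg_one {k : ℤ} {b : WithZero (Multiplicative ℤ)} (hb : b ≠ 0) :
    WithZero.exp k < b ↔ WithZero.exp k ≤ b * WithZero.exp (-1 : ℤ) := by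
  obtain ⟨n, hn⟩ : ∃ n : ℤ, b = WithZero.exp n := ⟨_, (WithZero.exp_log hb).symm⟩
  rw [hn, ← WithZero.exp_add, WithZero.exp_lt_exp, WithZero.exp_le_exp]
  omega

/-! ## §2 The two cases -/

section Wild

variable (h2v : Valued.v (2 : v.adicCompletion ↥(maximalRealSubfield L)) < 1)

include he h2v in
/-- **CASE `|ι u| < |2τ|` (`d = 2·ord_v 2 + 1`, skew uniformiser type)**: every unit of `L⁺_v` of depth `k` is a norm iff `exp(−k) ≤ |στ − τ|_w`.  Here `|στ − τ| = |2τ|`,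
`d₀ = u² + 4v` has odd order `|4v|`, and ★ B-p14 `IsCMField.norm_filtration_place_of_valued_odd` says: norm iff `|x − 1| < |4|`, sharp at `|x − 1| = |4|`.
[cite: Serre1979, Ch. V §3 Cor. 3, Ch. XV §2] [cite: Omeara1963, §63B] -/
theorem forall_exists_mul_galAdicCompletionMap_eq_iff_of_lt {τ : w.1.adicCompletion L} (hτ : Valued.v τ = WithZero.exp (-1 : ℤ))
    {u v₀ : v.adicCompletion ↥(maximalRealSubfield L)}
    (htr : τ + galAdicCompletionMap (L := L) (IsCMField.complexConj L) hw τ = toPlace v w u)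
    (hnm : τ * galAdicCompletionMap (L := L) (IsCMField.complexConj L) hw τ = -toPlace v w v₀) (hv₀ : Valued.v v₀ = WithZero.exp (-1 : ℤ))
    (hlt : Valued.v (toPlace v w u) < Valued.v (2 * τ)) (k : ℕ) :
    (∀ x : v.adicCompletion ↥(maximalRealSubfield L), Valued.v x = 1 → Valued.v (x - 1) ≤ WithZero.exp (-(k : ℤ)) →
        ∃ z : w.1.adicCompletion L, z * galAdicCompletionMap (L := L) (IsCMField.complexConj L) hw z = toPlace v w x) ↔
      WithZero.exp (-(k : ℤ)) ≤ Valued.v (galAdicCompletionMap (L := L) (IsCMField.complexConj L) hw τ - τ) := by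
  -- the skew generator `δ = τ − στ` and `d₀ = u² + 4 v₀`
  have hδσ := galAdicCompletionMap_sub_galAdicCompletionMap_self L v w hw τ
  have hδ0 : τ - galAdicCompletionMap (L := L) (IsCMField.complexConj L) hw τ ≠ 0 :=
    fun h => galAdicCompletionMap_ne_self_of_uniformizer L v w hw he hτ (sub_eq_zero.1 h).symm
  have hd : algebraMap (v.adicCompletion ↥(maximalRealSubfield L))
      (((⟨w.1, w.2⟩ : SemiLocal.Place ↥(maximalRealSubfield L) L v) : HeightOneSpectrum (𝓞 L)).adicCompletion L) (u ^ 2 + 4 * v₀) =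
      (τ - galAdicCompletionMap (L := L) (IsCMField.complexConj L) hw τ) * (τ - galAdicCompletionMap (L := L) (IsCMField.complexConj L) hw τ) := by
    rw [← toPlace_eq_algebraMap_place L v w]; exact toPlace_trace_sq_add_four_mul_eq L v w hw htr hnm
  -- values: `|u²| < |4 v₀| = |2|² exp(-1)`, so `|d₀| = |4 v₀|` is odd
  have h2 : (2 : v.adicCompletion ↥(maximalRealSubfield L)) ≠ 0 := by
    rw [show (2 : v.adicCompletion ↥(maximalRealSubfield L)) = algebraMap ↥(maximalRealSubfield L) _ 2 by rw [map_ofNat]]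
    exact (_root_.map_ne_zero (algebraMap ↥(maximalRealSubfield L) (v.adicCompletion ↥(maximalRealSubfield L)))).2 two_ne_zero
  have hv2 : Valued.v (2 : v.adicCompletion ↥(maximalRealSubfield L)) ≠ 0 := (Valuation.ne_zero_iff _).2 h2
  have h4v : Valued.v (4 * v₀) = Valued.v (2 : v.adicCompletion ↥(maximalRealSubfield L)) ^ 2 * WithZero.exp (-1 : ℤ) :=
    valued_four_mul_of_uniformizer L v hv₀
  have hu2 : Valued.v (u ^ 2) < Valued.v (4 * v₀) := by
    rw [map_pow, h4v, ← valued_toPlace_eq_sq_of_ramified L v w hw he, ← valued_two_mul_of_uniformizer L v w hw he hτ]; exact hlt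
  have hd₀ : Valued.v (u ^ 2 + 4 * v₀) = Valued.v (2 : v.adicCompletion ↥(maximalRealSubfield L)) ^ 2 * WithZero.exp (-1 : ℤ) := by
    rw [add_comm, Valuation.map_add_eq_of_lt_left _ hu2, h4v]
  have hdodd : ∀ y : v.adicCompletion ↥(maximalRealSubfield L), Valued.v (u ^ 2 + 4 * v₀) ≠ Valued.v y * Valued.v y := by
    intro y hy
    rw [hd₀, ← pow_two] at hy
    rcases eq_or_ne y 0 with hy0 | hy0
    · rw [hy0, map_zero, zero_pow two_ne_zero] at hy
      exact mul_ne_zero (pow_ne_zero _ hv2) WithZero.coe_ne_zero hy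
    · exact sq_ne_sq_mul_exp_neg_one ((Valuation.ne_zero_iff _).2 hy0) hv2 hy.symm
  -- B-p14's wild head I at the place `⟨w.1, w.2⟩`
  obtain ⟨hN, x₀, hx₀1, hx₀d, hx₀N⟩ :=
    Literature.NumberTheory.LocalFields.IsCMField.norm_filtration_place_of_valued_odd L
      (⟨w.1, w.2⟩ : SemiLocal.Place ↥(maximalRealSubfield L) L v) hw h2v hδσ hδ0 hd hdodd
  -- `|στ − τ| = |2τ| = |4|_v · exp(-1)` (as elements of `ℤᵐ⁰`)
  have hD : Valued.v (galAdicCompletionMap (L := L) (IsCMField.complexConj L) hw τ - τ) =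
      Valued.v (4 : v.adicCompletion ↥(maximalRealSubfield L)) * WithZero.exp (-1 : ℤ) := by
    rw [valued_galAdicCompletionMap_sub_self_of_uniformizer L v w hw he hτ htr, max_eq_right hlt.le, valued_two_mul_of_uniformizer L v w hw he hτ,
      show (4 : v.adicCompletion ↥(maximalRealSubfield L)) = 2 ^ 2 by norm_num, map_pow]
  have h4 : Valued.v (4 : v.adicCompletion ↥(maximalRealSubfield L)) ≠ 0 := by
    rw [show (4 : v.adicCompletion ↥(maximalRealSubfield L)) = 2 ^ 2 by norm_num, map_pow]; exact pow_ne_zero _ hv2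
  rw [hD, ← toPlace_eq_algebraMap_place L v w] at *
  constructor
  · intro hk
    -- the sharp unit `x₀` (`|x₀ − 1| = |4|`, not a norm) forces `exp(-k) < |4|`
    rw [← exp_lt_iff_le_mul_exp_neg_one h4]
    by_contra hle
    rw [not_lt] at hle
    exact hx₀N (hk x₀ hx₀1 (hx₀d.le.trans hle))
  · intro hk x hx hxk
    refine hN x (lt_of_le_of_lt (hxk.trans hk) ?_)
    -- `|4| · exp(-1) < |4|`
    obtain ⟨m, hm⟩ : ∃ m : ℤ, Valued.v (4 : v.adicCompletion ↥(maximalRealSubfield L)) = WithZero.exp m := ⟨_, (WithZero.exp_log h4).symm⟩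
    rw [hm, ← WithZero.exp_add, WithZero.exp_lt_exp]
    omega

include he h2v in
/-- **CASE `|2τ| < |ι u|` (`d = 2·ord_v u`, skew unit type)**: every unit of `L⁺_v` of depth `k` is a norm iff `exp(−k) ≤ |στ − τ|_w`.  Here `|στ − τ| = |ι u| = |u|²`, `u ≠ 0`,
`δ′ := ι u⁻¹ · (τ − στ)` has `δ′² = ι(1 + w′)` with `w′ = 4v ∕ u²` of odd valuation, `|4| < |w′| < 1`, and ★ B-p14 `IsCMField.norm_filtration_place_of_odd_defect` says: norm iff
`|w′ (x − 1)| < |4|`, i.e. `|x − 1| ≤ |u|²`, sharp one step below. [cite: Serre1979, Ch. V §3 Cor. 3, Ch. XV §2] [cite: Omeara1963, §63B] -/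
theorem forall_exists_mul_galAdicCompletionMap_eq_iff_of_gt {τ : w.1.adicCompletion L} (hτ : Valued.v τ = WithZero.exp (-1 : ℤ))
    {u v₀ : v.adicCompletion ↥(maximalRealSubfield L)}
    (htr : τ + galAdicCompletionMap (L := L) (IsCMField.complexConj L) hw τ = toPlace v w u)
    (hnm : τ * galAdicCompletionMap (L := L) (IsCMField.complexConj L) hw τ = -toPlace v w v₀) (hu1 : Valued.v u < 1) (hv₀ : Valued.v v₀ = WithZero.exp (-1 : ℤ))
    (hgt : Valued.v (2 * τ) < Valued.v (toPlace v w u)) (k : ℕ) :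
    (∀ x : v.adicCompletion ↥(maximalRealSubfield L), Valued.v x = 1 → Valued.v (x - 1) ≤ WithZero.exp (-(k : ℤ)) →
        ∃ z : w.1.adicCompletion L, z * galAdicCompletionMap (L := L) (IsCMField.complexConj L) hw z = toPlace v w x) ↔
      WithZero.exp (-(k : ℤ)) ≤ Valued.v (galAdicCompletionMap (L := L) (IsCMField.complexConj L) hw τ - τ) := by
  have h2 : (2 : v.adicCompletion ↥(maximalRealSubfield L)) ≠ 0 := by
    rw [show (2 : v.adicCompletion ↥(maximalRealSubfield L)) = algebraMap ↥(maximalRealSubfield L) _ 2 by rw [map_ofNat]]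
    exact (_root_.map_ne_zero (algebraMap ↥(maximalRealSubfield L) (v.adicCompletion ↥(maximalRealSubfield L)))).2 two_ne_zero
  have hv2 : Valued.v (2 : v.adicCompletion ↥(maximalRealSubfield L)) ≠ 0 := (Valuation.ne_zero_iff _).2 h2
  have h4 : Valued.v (4 : v.adicCompletion ↥(maximalRealSubfield L)) ≠ 0 := by
    rw [show (4 : v.adicCompletion ↥(maximalRealSubfield L)) = 2 ^ 2 by norm_num, map_pow]; exact pow_ne_zero _ hv2
  -- `u ≠ 0`
  have hu0 : u ≠ 0 := by
    rintro rfl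
    rw [map_zero, map_zero] at hgt
    exact not_lt_zero hgt
  have hvu : Valued.v u ≠ 0 := (Valuation.ne_zero_iff _).2 hu0
  have hιu : toPlace v w u ≠ 0 := (_root_.map_ne_zero (toPlace v w)).2 hu0
  -- the skew generator `δ′ = ι u⁻¹ · (τ − στ)` with `δ′² = ι(1 + w′)`, `w′ = 4 v₀ / u²`
  set w' : v.adicCompletion ↥(maximalRealSubfield L) := 4 * v₀ / u ^ 2 with hw'def
  have hδσ := galAdicCompletionMap_sub_galAdicCompletionMap_self L v w hw τ
  have hδ0 : τ - galAdicCompletionMap (L := L) (IsCMField.complexConj L) hw τ ≠ 0 :=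
    fun h => galAdicCompletionMap_ne_self_of_uniformizer L v w hw he hτ (sub_eq_zero.1 h).symm
  have hδ'σ : galAdicCompletionMap (L := L) (IsCMField.complexConj L) hw (toPlace v w u⁻¹ * (τ - galAdicCompletionMap (L := L) (IsCMField.complexConj L) hw τ)) =
      -(toPlace v w u⁻¹ * (τ - galAdicCompletionMap (L := L) (IsCMField.complexConj L) hw τ)) := by
    rw [map_mul, galAdicCompletionMap_toPlace (IsCMField.complexConj L) w w hw, hδσ, mul_neg]
  have hδ'0 : toPlace v w u⁻¹ * (τ - galAdicCompletionMap (L := L) (IsCMField.complexConj L) hw τ) ≠ 0 :=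
    mul_ne_zero (by rw [map_inv₀]; exact inv_ne_zero hιu) hδ0
  have hd : algebraMap (v.adicCompletion ↥(maximalRealSubfield L))
      (((⟨w.1, w.2⟩ : SemiLocal.Place ↥(maximalRealSubfield L) L v) : HeightOneSpectrum (𝓞 L)).adicCompletion L) (1 + w') =
      (toPlace v w u⁻¹ * (τ - galAdicCompletionMap (L := L) (IsCMField.complexConj L) hw τ)) *
        (toPlace v w u⁻¹ * (τ - galAdicCompletionMap (L := L) (IsCMField.complexConj L) hw τ)) := by
    rw [← toPlace_eq_algebraMap_place L v w]
    have key := toPlace_trace_sq_add_four_mul_eq L v w hw htr hnm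
    have h1w : 1 + w' = (u⁻¹) ^ 2 * (u ^ 2 + 4 * v₀) := by
      rw [hw'def]; field_simp
    rw [h1w, map_mul, map_pow, key]
    ring
  -- exponents: `|u| = exp m` (`m < 0`), `|2|_v = exp n`; `|4 v₀| = exp (2n − 1)`, `|u²| = exp 2m`, `|w′| = exp (2n − 1 − 2m)`
  obtain ⟨m, hm⟩ : ∃ m : ℤ, Valued.v u = WithZero.exp m := ⟨_, (WithZero.exp_log hvu).symm⟩
  obtain ⟨n, hn⟩ : ∃ n : ℤ, Valued.v (2 : v.adicCompletion ↥(maximalRealSubfield L)) = WithZero.exp n := ⟨_, (WithZero.exp_log hv2).symm⟩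
  have hm0 : m < 0 := by rw [hm, ← WithZero.exp_zero, WithZero.exp_lt_exp] at hu1; exact hu1
  have h4v : Valued.v (4 * v₀) = WithZero.exp (2 * n - 1) := by
    rw [valued_four_mul_of_uniformizer L v hv₀, hn, ← WithZero.exp_nsmul, ← WithZero.exp_add]
    simp only [nsmul_eq_mul, Nat.cast_ofNat]; ring_nf
  have h4e : Valued.v (4 : v.adicCompletion ↥(maximalRealSubfield L)) = WithZero.exp (2 * n) := by
    rw [show (4 : v.adicCompletion ↥(maximalRealSubfield L)) = 2 ^ 2 by norm_num, map_pow, hn, ← WithZero.exp_nsmul]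
    simp only [nsmul_eq_mul, Nat.cast_ofNat]
  have hu2e : Valued.v u ^ 2 = WithZero.exp (2 * m) := by
    rw [hm, ← WithZero.exp_nsmul]; simp only [nsmul_eq_mul, Nat.cast_ofNat]
  have hmn : 2 * n - 1 < 2 * m := by
    have h := hgt
    rw [valued_two_mul_of_uniformizer L v w hw he hτ, valued_toPlace_eq_sq_of_ramified L v w hw he, hu2e, hn, ← WithZero.exp_nsmul, ← WithZero.exp_add,
      WithZero.exp_lt_exp] at h
    simp only [nsmul_eq_mul, Nat.cast_ofNat] at h
    linarith
  have hw'e : Valued.v w' = WithZero.exp (2 * n - 1 - 2 * m) := by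
    rw [hw'def, map_div₀, map_pow, h4v, hu2e, ← WithZero.exp_sub]
  have hw1 : Valued.v w' < 1 := by rw [hw'e, ← WithZero.exp_zero, WithZero.exp_lt_exp]; omega
  have h4w : Valued.v (4 : v.adicCompletion ↥(maximalRealSubfield L)) < Valued.v w' := by rw [hw'e, h4e, WithZero.exp_lt_exp]; omega
  have hw'0 : Valued.v w' ≠ 0 := by rw [hw'e]; exact WithZero.coe_ne_zero
  have hwodd : ∀ y : v.adicCompletion ↥(maximalRealSubfield L), Valued.v w' ≠ Valued.v y * Valued.v y := by
    intro y hy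
    rcases eq_or_ne y 0 with hy0 | hy0
    · rw [hy0, map_zero, mul_zero] at hy; exact hw'0 hy
    obtain ⟨t, ht⟩ : ∃ t : ℤ, Valued.v y = WithZero.exp t := ⟨_, (WithZero.exp_log ((Valuation.ne_zero_iff _).2 hy0)).symm⟩
    rw [hw'e, ht, ← WithZero.exp_add, WithZero.exp_inj] at hy
    omega
  -- B-p14's wild head II at the place `⟨w.1, w.2⟩`
  obtain ⟨hN, x₀, hx₀1, hx₀d, hx₀N⟩ :=
    Literature.NumberTheory.LocalFields.IsCMField.norm_filtration_place_of_odd_defect L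
      (⟨w.1, w.2⟩ : SemiLocal.Place ↥(maximalRealSubfield L) L v) hw h2v hδ'σ hδ'0 hd hw1 h4w hwodd
  -- `D := |στ − τ| = |ι u| = |u|² = exp 2m`
  have hD : Valued.v (galAdicCompletionMap (L := L) (IsCMField.complexConj L) hw τ - τ) = WithZero.exp (2 * m) := by
    rw [valued_galAdicCompletionMap_sub_self_of_uniformizer L v w hw he hτ htr, max_eq_left hgt.le, valued_toPlace_eq_sq_of_ramified L v w hw he, hu2e]
  -- `|w′ (x − 1)| < |4| ↔ |x − 1| ≤ D`
  have hkey : ∀ x : v.adicCompletion ↥(maximalRealSubfield L), Valued.v (w' * (x - 1)) < Valued.v (4 : v.adicCompletion ↥(maximalRealSubfield L)) ↔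
      Valued.v (x - 1) ≤ WithZero.exp (2 * m) := by
    intro x
    rw [map_mul, hw'e, h4e]
    rcases eq_or_ne (x - 1) 0 with hx0 | hx0
    · rw [hx0, map_zero, mul_zero]; exact ⟨fun _ => zero_le, fun _ => zero_lt_iff.2 WithZero.coe_ne_zero⟩
    obtain ⟨t, ht⟩ : ∃ t : ℤ, Valued.v (x - 1) = WithZero.exp t := ⟨_, (WithZero.exp_log ((Valuation.ne_zero_iff _).2 hx0)).symm⟩
    rw [ht, ← WithZero.exp_add, WithZero.exp_lt_exp, WithZero.exp_le_exp]
    omega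
  rw [hD, ← toPlace_eq_algebraMap_place L v w] at *
  constructor
  · intro hk
    by_contra hle
    rw [not_le, WithZero.exp_lt_exp] at hle
    -- `|x₀ − 1| = exp (2m + 1) ≤ exp(-k)`, so `x₀` would be a norm
    have hx₀v : Valued.v (x₀ - 1) = WithZero.exp (2 * m + 1) := by
      have hx1 : x₀ - 1 ≠ 0 := by
        intro h0; rw [h0, mul_zero, map_zero] at hx₀d; exact h4 hx₀d.symm
      obtain ⟨t, ht⟩ : ∃ t : ℤ, Valued.v (x₀ - 1) = WithZero.exp t := ⟨_, (WithZero.exp_log ((Valuation.ne_zero_iff _).2 hx1)).symm⟩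
      rw [map_mul, hw'e, ht, h4e, ← WithZero.exp_add, WithZero.exp_inj] at hx₀d
      rw [ht]; congr 1; omega
    exact hx₀N (hk x₀ hx₀1 (by rw [hx₀v, WithZero.exp_le_exp]; omega))
  · intro hk x hx hxk
    exact hN x ((hkey x).2 (hxk.trans hk))

/-! ## §3 DIFFERENT = CONDUCTOR -/

include he h2v in
/-- **DIFFERENT = CONDUCTOR AT A WILD RAMIFIED CM PLACE.**  `L` CM, `w ∣ v` non-split ramified, `|2|_v < 1`, `τ` ANY uniformiser of `L_w`.  For every `k : ℕ`: every unit
`x ∈ L⁺_v` with `|x − 1|_v ≤ exp(−k)` is a norm `z · σ_w z` from `L_w` **iff** `exp(−k) ≤ |σ_w τ − τ|_w` — the conductor of `L_w ∕ L⁺_v` (★ `IsCMField.conductor_iff_place`: the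
least `k` with `U^{(k)} ⊆ N`) is the different number `d` (★ `exists_different_of_ramified`).  The quadratic case of Serre V §3 Cor. 3 (`N(U_L^{(ψ(n))}) = U_K^{(n)}`, `n > t`,
`t = d − 1`) ∕ of the conductor–discriminant formula. [cite: Serre1979, Ch. V §3 Cor. 3, Ch. XV §2] [cite: NeukirchANT1999, Ch. VII (11.9)] [cite: Omeara1963, §63B] -/
theorem forall_exists_mul_galAdicCompletionMap_eq_iff_exp_neg_le {τ : w.1.adicCompletion L} (hτ : Valued.v τ = WithZero.exp (-1 : ℤ)) (k : ℕ) :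
    (∀ x : v.adicCompletion ↥(maximalRealSubfield L), Valued.v x = 1 → Valued.v (x - 1) ≤ WithZero.exp (-(k : ℤ)) →
        ∃ z : w.1.adicCompletion L, z * galAdicCompletionMap (L := L) (IsCMField.complexConj L) hw z = toPlace v w x) ↔
      WithZero.exp (-(k : ℤ)) ≤ Valued.v (galAdicCompletionMap (L := L) (IsCMField.complexConj L) hw τ - τ) := by
  obtain ⟨u, v₀, htr, hnm, hu1, hv₀⟩ := exists_eisenstein_coeffs_of_ramified L v w hw he hτ
  -- the two values `|ι u|`, `|2τ|` differ (parity), so one of the two cases applies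
  rcases lt_trichotomy (Valued.v (toPlace v w u)) (Valued.v (2 * τ)) with hlt | heq | hgt
  · exact forall_exists_mul_galAdicCompletionMap_eq_iff_of_lt L v w hw he h2v hτ htr hnm hv₀ hlt k
  · exfalso
    rcases eq_or_ne u 0 with hu0 | hu0
    · rw [hu0, map_zero, map_zero] at heq
      have h2w : (2 : w.1.adicCompletion L) ≠ 0 := by
        rw [show (2 : w.1.adicCompletion L) = algebraMap L _ 2 by rw [map_ofNat]]
        exact (_root_.map_ne_zero (algebraMap L (w.1.adicCompletion L))).2 two_ne_zero
      have hτ0 : τ ≠ 0 := fun h => by rw [h, map_zero] at hτ; exact WithZero.zero_ne_coe hτ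
      exact mul_ne_zero h2w hτ0 ((Valuation.zero_iff _).1 heq.symm)
    · rw [valued_toPlace_eq_sq_of_ramified L v w hw he, valued_two_mul_of_uniformizer L v w hw he hτ] at heq
      have h2 : (2 : v.adicCompletion ↥(maximalRealSubfield L)) ≠ 0 := by
        rw [show (2 : v.adicCompletion ↥(maximalRealSubfield L)) = algebraMap ↥(maximalRealSubfield L) _ 2 by rw [map_ofNat]]
        exact (_root_.map_ne_zero (algebraMap ↥(maximalRealSubfield L) (v.adicCompletion ↥(maximalRealSubfield L)))).2 two_ne_zero
      exact sq_ne_sq_mul_exp_neg_one ((Valuation.ne_zero_iff _).2 hu0) ((Valuation.ne_zero_iff _).2 h2) heq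
  · exact forall_exists_mul_galAdicCompletionMap_eq_iff_of_gt L v w hw he h2v hτ htr hnm hu1 hv₀ hgt k

include he h2v in
/-- **COROLLARY (the package form)**: at a wild ramified CM place there is `d : ℕ`, `1 ≤ d`, with `|σ_w τ − τ|_w = exp(−d)` for every uniformiser `τ` AND, for every `k`,
`U^{(k)}(L⁺_v) ⊆ N(L_w) ↔ d ≤ k` — the different number is the conductor. [cite: Serre1979, Ch. V §3 Cor. 3, Ch. IV §1 Prop. 4, Ch. XV §2] [cite: NeukirchANT1999, Ch. VII (11.9)] -/
theorem exists_different_eq_conductor_of_ramified :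
    ∃ d : ℕ, 1 ≤ d ∧
      (∀ τ : w.1.adicCompletion L, Valued.v τ = WithZero.exp (-1 : ℤ) →
        Valued.v (galAdicCompletionMap (L := L) (IsCMField.complexConj L) hw τ - τ) = WithZero.exp (-(d : ℤ))) ∧
      ∀ k : ℕ, (∀ x : v.adicCompletion ↥(maximalRealSubfield L), Valued.v x = 1 → Valued.v (x - 1) ≤ WithZero.exp (-(k : ℤ)) →
          ∃ z : w.1.adicCompletion L, z * galAdicCompletionMap (L := L) (IsCMField.complexConj L) hw z = toPlace v w x) ↔ d ≤ k := by
  obtain ⟨d, hd1, hdτ, -, -, -, -, -⟩ := exists_different_of_ramified L v w hw he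
  obtain ⟨π, hπ⟩ := w.1.valuation_exists_uniformizer L
  have hτ : Valued.v (π : w.1.adicCompletion L) = WithZero.exp (-1 : ℤ) := by rw [HeightOneSpectrum.valuedAdicCompletion_eq_valuation', hπ]
  refine ⟨d, hd1, hdτ, fun k => ?_⟩
  rw [forall_exists_mul_galAdicCompletionMap_eq_iff_exp_neg_le L v w hw he h2v hτ k, hdτ _ hτ, WithZero.exp_le_exp]
  omega

end Wild

end Literature.NumberTheory.Automorphic.UnitaryGroup

end
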